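import Summits.HodgeConjecture.HodgeConjecture.Theorems.Ring2AbelianAllAndreWeilFieldIsogenyAnchors
import Summits.HodgeConjecture.HodgeConjecture.Theorems.Ring2AbelianAllAndreCMTwistedSquareWeilType
import HarnessLib

/-!
# Ring 2 · AbelianAll — ANDRÉ AXIS, PART S-d: COMPACT PENCILS THROUGH A CM-FIELD TWISTED SQUARE — on a compact pencil of abelian `2ke₀`-folds with
  a global `E`-action (`E = ℚ[T]/(R(T²))` a CM field of ANY degree `2e₀`) through a chart `E`-isogenous to a twisted square `(T × T, η × (−η))`
  (`R(η²) = 0` on `T`, `dim T = k·e₀`, ANY multiplicities): every member is of Weil type relative to `E`; if the Hodge conjecture holds for `T × T`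
  (e.g. `T = S × S`, `S` stably nondegenerate — a simple CM abelian variety of prime dimension `e₀`), `B⋆` of the ONE total space ⟹ the `E`-Weil
  classes of EVERY member are algebraic (fact-free); smallest: the EIGHTFOLD pencils through `S² × S̄²`, `S` a CM abelian surface with quartic `E`

HONEST FRAMING (page 1, verbatim): **research route, not a corollary; conditional on HC_CM plus one named minimal statement.** Cell line:
research route conditional on HC_CM; not a corollary; Q11.4-sentence-2 already refuted in dim ≥ 3. Nothing in this file proves a case of the
Hodge conjecture beyond what the tree proves outright (powers of a stably nondegenerate abelian variety) or of `B(X)` for a named `X`: the pencil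
rows are IMPLICATIONS with displayed hypotheses. `HC_CM`, `HC_AV`, the global nodes and Verdier's binder do NOT occur. Item
`Theses.RankFourFaces.CMToAbelian` (stmt-16267) stays OPEN; N104 untouched; no node is born (0 `def`, 0 `sorry`, no named fact). Seat
`pub-hodge-ring2-ab-andre-2`, gen 49 (part S: CM-field component anchors and twisted squares; owed item (o156)). This is the CM-field form of
part O-c (gen 45: pencils of `ℚ(√−d)`-Weil `2g`-folds through a chart `K`-isogenous to a twisted square `T × T̄`), composed from part S-a (rows
through an `E`-isogenous anchor; Weil type along `E`-isogeny pairs) and part S-c (the CM-field twisted square is `IsWeilTypeCM`; HC at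
`S² × S̄²` for stably nondegenerate `S`).

## Content (theorems only; standard axioms)

* §1 **`isWeilTypeCM_member_of_isogenyPair_twistedSquareChart`** — WEIL TYPE OF EVERY MEMBER: compact pencil of abelian `d`-folds, global
  `E`-action (`Φ`; charts `(A_s, e_s, φ_s)` with `R(φ_s²) = 0`), a rational global `U` on `W_E(A_t) ⊗ ℂ` at `t` with `U|X_t ≠ 0`, ONE chart `A_{s₀}`
  linked to the twisted square `(T × T, η × (−η))` (`R(η²) = 0`, `dim T = k·e₀`) by `u : A_{s₀} ⟶ T × T` intertwining and `v` with `v ≫ u = n·𝟙`,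
  `dim A_{s₀} = dim (T × T)` ⟹ `IsWeilTypeCM (A s) (φ s) R e₀ k` for EVERY `s`. No `B⋆`, no HC.
* §2 **`weilClassesField_le_algebraicClasses_forall_of_lefschetzB_of_isogenyPair_twistedSquareChart`** — THE ROW: the same pencil, of relative
  dimension `2ke₀`, with `B⋆(𝒳, η) ∀η` and an `E`-isogeny pair `(u, v)` between `A_{s₀}` and `T × T` (`u ≫ v = n·𝟙`, `v ≫ φ_{s₀} = (η × (−η)) ≫ v`);
  if the HODGE CONJECTURE holds for `T × T`, then `W_E(A_s, φ_s) ⊗ ℂ ⊆ Nᵏ(A_s)` for EVERY member (part S-c §4 at the anchor, part S-a §3).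
* §3 **`weilClassesField_le_algebraicClasses_forall_of_lefschetzB_of_isogenyPair_sqTwistedSquareChart`** — THE CM-FIELD `B × B̄` PENCILS: `S`
  STABLY NONDEGENERATE of dimension `e₀` with `R(η_S²) = 0`, `T = S × S` with the diagonal `E`-action: compact pencils of abelian `4e₀`-folds with
  a global `E`-action through a chart `E`-isogenous to `S² × S̄²` — `B⋆` of the ONE `(4e₀+1)`-fold total space ⟹ the CODIMENSION-2 `E`-Weil
  classes of EVERY member are algebraic (HC at the anchor is the tree's theorem; no hypothesis on the anchor remains); `…_of_endField_prime` —
  `S` of PRIME dimension with a number field of degree `2 dim S` in `End⁰(S)` (a simple CM abelian variety of prime dimension `e₀` with CM by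
  `E`; Yanai). Smallest: `e₀ = 2`, `S` a simple CM abelian SURFACE with quartic CM field `E` (Galois or not) — pencils of abelian EIGHTFOLDS
  through `S² × S̄²`, ONE 9-fold total space, codimension-2 `E`-Weil classes.

## Honest status

Fact-free. The δ-components met by the twisted-square anchors are not computed here (no CM-field discriminant of `T × T̄`; for δ-indexed anchors
see part S-b, importing ring2-b03's `B^p × (B^ρ)^p` rows — for `T = S^p` the twisted square IS that member, presentation-free). Existence of compact
pencils with a global `E`-action through a given member is NOT constructed (hypotheses, as on the whole axis). The open input is unchanged:
`B⋆` of the one total space; in print the `E`-Weil classes with `E⁺ ≠ ℚ` are open on every component ([Andre2026, §4.4.4]). Nothing minimal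
claimed; N104 untouched. EDGE LABELS: all theorems K (fact-free).
References: Deligne1982HodgeCycles (§4 (4.4), Prop. 4.4, Remark 4.10, proof of Thm. 4.8; §5 (c) p. 38); MoonenZarhin1998WeilClasses (§1);
Andre1996Motifs (§6.3 Lemme 6.3.3, Remarque 2); Abdulali1994FamiliesAV (Thm. 5.5); Gordon1999HodgeAVSurvey (Thm. 6.3, Def. 7.6); Yanai1985;
Andre2026 (§4.4.4).
-/

noncomputable section

set_option linter.dupNamespace false

namespace Summit.HodgeConjecture.HodgeConjecture.Ring2.AbelianAll

open CategoryTheory AlgebraicGeometry Polynomial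
open Literature.AlgebraicGeometry Literature.AlgebraicGeometry.Motives
open Literature.AlgebraicGeometry.HodgeTheory Literature.AlgebraicGeometry.Deligne1982
open Literature.AlgebraicGeometry.ComplexMultiplication (EndFieldFullDegree.isStablyNondegenerate_of_prime)

variable {𝒳 S : SchemeOver ℂ} {f : 𝒳 ⟶ S} {d : ℕ}
variable {T : AbelianVariety ℂ} {η : T ⟶ T} {R : Polynomial ℤ} {e₀ k : ℕ}

/-! ## §1 Every member is of Weil type relative to `E` -/

/-- **EVERY MEMBER OF A COMPACT `E`-PENCIL THROUGH A CM-FIELD TWISTED SQUARE IS OF WEIL TYPE RELATIVE TO `E`.** `R ∈ ℤ[S]` monic of degree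
`e₀ ≥ 1`, roots real negative, `R(T²)` irreducible over `ℚ`; `T` a complex abelian variety of dimension `k·e₀` (`k ≥ 1`) with `η : T ⟶ T`,
`R(η²) = 0` (ANY multiplicities). Compact pencil `f : 𝒳 ⟶ S` of abelian `d`-folds with a global endomorphism `Φ` over `S`, `Φ`-compatible charts
`(A_s, e_s, φ_s)` with `R(φ_s²) = 0`, a RATIONAL global `U ∈ H^{2k}(𝒳(ℂ); ℂ)` with `e_t^*(U|X_t) ∈ W_E(A_t, φ_t) ⊗ ℂ` and `U|X_t ≠ 0`, and ONE chart
`A_{s₀}` with `dim A_{s₀} = dim (T × T)` linked to the twisted square by `u : A_{s₀} ⟶ T × T` with `u ≫ (η × (−η)) = φ_{s₀} ≫ u` and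
`v : T × T ⟶ A_{s₀}` with `v ≫ u = n·𝟙` (`n ≥ 1`) ⟹ **`IsWeilTypeCM (A s) (φ s) R e₀ k` for EVERY member `s`** (the twisted square is of Weil
type — part S-c; Weil type passes along the pair — part S-a §2; and along the pencil — part R-c). No `B⋆`, no HC.
[cite: Deligne1982HodgeCycles, §4 (4.4), Prop. 4.4 and proof of Thm. 4.8 (a)] [cite: MoonenZarhin1998WeilClasses, §1 (Criterion; n_σ + n_σ' = 2g/[F:ℚ])]
[cite: Andre1996Motifs, §6.3 Lemme 6.3.3 (iii) (p. 33)] -/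
theorem isWeilTypeCM_member_of_isogenyPair_twistedSquareChart (he : 0 < e₀) (hk : 0 < k) (hRm : R.Monic) (hRe : R.natDegree = e₀)
    (hirr : Irreducible ((R.comp (X ^ 2)).map (Int.castRingHom ℚ)))
    (hroots : ∀ s : ℂ, Polynomial.eval₂ (Int.castRingHom ℂ) s R = 0 → s.im = 0 ∧ s.re < 0)
    (hη : Polynomial.eval₂ (Int.castRingHom (CategoryTheory.End T)) (η : CategoryTheory.End T) (R.comp (X ^ 2)) = 0)
    (hT : T.dim = k * e₀)
    (hf : IsCompactAbelianPencil f d) (Φ : 𝒳 ⟶ 𝒳) (hΦ : Φ ≫ f = f)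
    (A : ComplexPoints S → AbelianVariety ℂ) (e : ∀ s, (A s).X ≅ fiberOver f s) (φ : ∀ s, A s ⟶ A s)
    (hK : ∀ s, ∃ Φs : fiberOver f s ⟶ fiberOver f s, Φs ≫ fiberι f s = fiberι f s ≫ Φ ∧ (e s).hom ≫ Φs = (φ s).hom.hom.hom ≫ (e s).hom)
    (hP : ∀ s, Polynomial.eval₂ (Int.castRingHom (CategoryTheory.End (A s))) ((φ s : CategoryTheory.End (A s)))
      (R.comp (X ^ 2)) = 0)
    (U : complexBetti 𝒳 (2 * k)) (hUQ : IsRationalClass U) {t : ComplexPoints S}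
    (hUt : complexBetti.map (e t).hom (2 * k) (complexBetti.map (fiberι f t) (2 * k) U) ∈
      weilClassesField (A t) (φ t) (R.comp (X ^ 2)) (2 * k))
    (hU0 : complexBetti.map (fiberι f t) (2 * k) U ≠ 0)
    {s₀ : ComplexPoints S} (hdim : (A s₀).dim = (T.prod T).dim) (u : A s₀ ⟶ T.prod T) (v : T.prod T ⟶ A s₀) {n : ℕ} (hn : 0 < n)
    (hvu : v ≫ u = n • 𝟙 (T.prod T))
    (hu : u ≫ AbelianVariety.prodLift (AbelianVariety.fst T T ≫ η) (AbelianVariety.snd T T ≫ (-η)) = φ s₀ ≫ u)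
    (s : ComplexPoints S) :
    IsWeilTypeCM (A s) (φ s) R e₀ k :=
  isWeilTypeCM_member_of_isogenyPair_weilTypeCM_chart hf Φ hΦ A e φ hK hP U hUQ hUt hU0
    (isWeilTypeCM_twistedSquare he hk hRm hRe hirr hroots hη hT) hdim u v hn hvu hu s

/-! ## §2 The row: `B⋆` of the one total space ⟹ the `E`-Weil classes of every member, through a twisted-square chart with HC -/

/-- **THE ROW THROUGH A CM-FIELD TWISTED SQUARE SATISFYING THE HODGE CONJECTURE.** `(R, e₀)`, `T`, `η`, `k` as above, and assume the Hodge
conjecture holds for `T × T` (e.g. §3). Compact pencil `f : 𝒳 ⟶ S` of abelian `2ke₀`-folds with `B⋆(𝒳, η')` for every `η'`, a global endomorphism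
`Φ` over `S`, `Φ`-compatible charts `(A_s, e_s, φ_s)` with `R(φ_s²) = 0`, a rational global `U` on `W_E(A_t) ⊗ ℂ` at `t` with `U|X_t ≠ 0`, and an
`E`-isogeny pair between ONE chart `A_{s₀}` and the twisted square (`u : A_{s₀} ⟶ T × T`, `v : T × T ⟶ A_{s₀}`, `u ≫ v = n·𝟙`, `n ≥ 1`,
`v ≫ φ_{s₀} = (η × (−η)) ≫ v`) ⟹ **`W_E(A_s, φ_s) ⊗ ℂ ⊆ Nᵏ(A_s)` for EVERY member `s`.** (`W_E(T × T̄)` is algebraic — part S-c §4 —, passes to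
the chart along the pair, and part R-b's one-class row propagates it.) No θ_N, no group law, no Verdier, no `HC_CM`.
[cite: Deligne1982HodgeCycles, §4 Prop. 4.4, Remark 4.10 and proof of Thm. 4.8] [cite: MoonenZarhin1998WeilClasses, §1 (dim_F W_F = 1)]
[cite: Andre1996Motifs, §6.3 Lemme 6.3.3 and Remarque 2 (p. 33)] [cite: Abdulali1994FamiliesAV, Theorem 5.5 (p. 1130)] -/
theorem weilClassesField_le_algebraicClasses_forall_of_lefschetzB_of_isogenyPair_twistedSquareChart (he : 0 < e₀) (hk : 0 < k)
    (hRm : R.Monic) (hRe : R.natDegree = e₀) (hirr : Irreducible ((R.comp (X ^ 2)).map (Int.castRingHom ℚ)))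
    (hroots : ∀ s : ℂ, Polynomial.eval₂ (Int.castRingHom ℂ) s R = 0 → s.im = 0 ∧ s.re < 0)
    (hη : Polynomial.eval₂ (Int.castRingHom (CategoryTheory.End T)) (η : CategoryTheory.End T) (R.comp (X ^ 2)) = 0)
    (hT : T.dim = k * e₀) (hHC : HodgeConjectureFor (T.prod T).dim (T.prod T).X)
    (hf : IsCompactAbelianPencil f (2 * k * e₀)) (hB : ∀ ηX : complexBetti 𝒳 2, StandardConjectureBStar (2 * k * e₀ + 1) 𝒳 ηX)
    (Φ : 𝒳 ⟶ 𝒳) (hΦ : Φ ≫ f = f)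
    (A : ComplexPoints S → AbelianVariety ℂ) (e : ∀ s, (A s).X ≅ fiberOver f s) (φ : ∀ s, A s ⟶ A s)
    (hK : ∀ s, ∃ Φs : fiberOver f s ⟶ fiberOver f s, Φs ≫ fiberι f s = fiberι f s ≫ Φ ∧ (e s).hom ≫ Φs = (φ s).hom.hom.hom ≫ (e s).hom)
    (hP : ∀ s, Polynomial.eval₂ (Int.castRingHom (CategoryTheory.End (A s))) ((φ s : CategoryTheory.End (A s)))
      (R.comp (X ^ 2)) = 0)
    (U : complexBetti 𝒳 (2 * k)) (hUQ : IsRationalClass U) {t : ComplexPoints S}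
    (hUt : complexBetti.map (e t).hom (2 * k) (complexBetti.map (fiberι f t) (2 * k) U) ∈
      weilClassesField (A t) (φ t) (R.comp (X ^ 2)) (2 * k))
    (hU0 : complexBetti.map (fiberι f t) (2 * k) U ≠ 0)
    {s₀ : ComplexPoints S} (u : A s₀ ⟶ T.prod T) (v : T.prod T ⟶ A s₀) {n : ℕ} (hn : 0 < n) (huv : u ≫ v = n • 𝟙 (A s₀))
    (hv : v ≫ φ s₀ = AbelianVariety.prodLift (AbelianVariety.fst T T ≫ η) (AbelianVariety.snd T T ≫ (-η)) ≫ v)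
    (s : ComplexPoints S) :
    weilClassesField (A s) (φ s) (R.comp (X ^ 2)) (2 * k) ≤ algebraicClasses (A s).X k :=
  weilClassesField_le_algebraicClasses_forall_of_lefschetzB_of_isogenyPair_weilTypeCM_hodge_chart hf hB Φ hΦ A e φ hK hP U hUQ hUt hU0
    (isWeilTypeCM_twistedSquare he hk hRm hRe hirr hroots hη hT) hHC u v hn huv hv s

/-! ## §3 The CM-field `B × B̄` pencils: through `S² × S̄²`, `S` stably nondegenerate -/

section SqTwistedSquare

variable {S₀ : AbelianVariety ℂ} {ηS : S₀ ⟶ S₀}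

/-- **THE CM-FIELD `B × B̄` PENCILS — codimension-2 `E`-Weil classes from `B⋆` of ONE total space, anchor hypothesis-free.** `E = ℚ[T]/(R(T²))` a
CM field of degree `2e₀` (`R` monic of degree `e₀ ≥ 1`, roots real negative, `R(T²)` irreducible), `S₀` a STABLY NONDEGENERATE complex abelian
variety of dimension `e₀` with `η_S : S₀ ⟶ S₀`, `R(η_S²) = 0`; `T = S₀ × S₀` with the diagonal action, anchor `T × T̄ = S₀² × S̄₀²` (a `4e₀`-fold of
Weil type `(R, e₀, 2)` satisfying HC, part S-c). For EVERY compact pencil `f : 𝒳 ⟶ S` of abelian `4e₀`-folds with `B⋆(𝒳, η')` for every `η'`, a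
global endomorphism `Φ` over `S`, `Φ`-compatible charts `(A_s, e_s, φ_s)` with `R(φ_s²) = 0`, a rational global `U ∈ H⁴(𝒳(ℂ); ℂ)` on `W_E(A_t) ⊗ ℂ`
at `t` with `U|X_t ≠ 0`, and an `E`-isogeny pair between ONE chart and the anchor: **the codimension-2 `E`-Weil classes of EVERY member are
algebraic, `W_E(A_s, φ_s) ⊗ ℂ ⊆ N²(A_s)`.** [cite: Deligne1982HodgeCycles, §4 Prop. 4.4, Remark 4.10 and §5 (c) p. 38]
[cite: Gordon1999HodgeAVSurvey, Thm. 7.5 (1) and Def. 7.6] [cite: Andre1996Motifs, §6.3 Lemme 6.3.3 and Remarque 2 (p. 33)] [cite: Andre2026, §4.4.4] -/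
theorem weilClassesField_le_algebraicClasses_forall_of_lefschetzB_of_isogenyPair_sqTwistedSquareChart (he : 0 < e₀) (hRm : R.Monic)
    (hRe : R.natDegree = e₀) (hirr : Irreducible ((R.comp (X ^ 2)).map (Int.castRingHom ℚ)))
    (hroots : ∀ s : ℂ, Polynomial.eval₂ (Int.castRingHom ℂ) s R = 0 → s.im = 0 ∧ s.re < 0)
    (hηS : Polynomial.eval₂ (Int.castRingHom (CategoryTheory.End S₀)) (ηS : CategoryTheory.End S₀) (R.comp (X ^ 2)) = 0)
    (hS : S₀.dim = e₀) (hSt : IsStablyNondegenerate S₀)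
    (hf : IsCompactAbelianPencil f (2 * 2 * e₀)) (hB : ∀ ηX : complexBetti 𝒳 2, StandardConjectureBStar (2 * 2 * e₀ + 1) 𝒳 ηX)
    (Φ : 𝒳 ⟶ 𝒳) (hΦ : Φ ≫ f = f)
    (A : ComplexPoints S → AbelianVariety ℂ) (e : ∀ s, (A s).X ≅ fiberOver f s) (φ : ∀ s, A s ⟶ A s)
    (hK : ∀ s, ∃ Φs : fiberOver f s ⟶ fiberOver f s, Φs ≫ fiberι f s = fiberι f s ≫ Φ ∧ (e s).hom ≫ Φs = (φ s).hom.hom.hom ≫ (e s).hom)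
    (hP : ∀ s, Polynomial.eval₂ (Int.castRingHom (CategoryTheory.End (A s))) ((φ s : CategoryTheory.End (A s)))
      (R.comp (X ^ 2)) = 0)
    (U : complexBetti 𝒳 (2 * 2)) (hUQ : IsRationalClass U) {t : ComplexPoints S}
    (hUt : complexBetti.map (e t).hom (2 * 2) (complexBetti.map (fiberι f t) (2 * 2) U) ∈
      weilClassesField (A t) (φ t) (R.comp (X ^ 2)) (2 * 2))
    (hU0 : complexBetti.map (fiberι f t) (2 * 2) U ≠ 0)
    {s₀ : ComplexPoints S} (u : A s₀ ⟶ (S₀.prod S₀).prod (S₀.prod S₀)) (v : (S₀.prod S₀).prod (S₀.prod S₀) ⟶ A s₀) {n : ℕ}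
    (hn : 0 < n) (huv : u ≫ v = n • 𝟙 (A s₀))
    (hv : v ≫ φ s₀ =
      AbelianVariety.prodLift
        (AbelianVariety.fst (S₀.prod S₀) (S₀.prod S₀) ≫
          AbelianVariety.prodLift (AbelianVariety.fst S₀ S₀ ≫ ηS) (AbelianVariety.snd S₀ S₀ ≫ ηS))
        (AbelianVariety.snd (S₀.prod S₀) (S₀.prod S₀) ≫
          (-AbelianVariety.prodLift (AbelianVariety.fst S₀ S₀ ≫ ηS) (AbelianVariety.snd S₀ S₀ ≫ ηS))) ≫ v)
    (s : ComplexPoints S) :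
    weilClassesField (A s) (φ s) (R.comp (X ^ 2)) (2 * 2) ≤ algebraicClasses (A s).X 2 := by
  have hT : (S₀.prod S₀).dim = 2 * e₀ := by rw [AbelianVariety.dim_prod, hS]; ring
  exact weilClassesField_le_algebraicClasses_forall_of_lefschetzB_of_isogenyPair_twistedSquareChart he two_pos hRm hRe hirr hroots
    (eval₂_diagSquare_comp_X_sq_eq_zero hηS) hT (hodgeConjectureFor_sq_prod_sq_of_isStablyNondegenerate hSt) hf hB Φ hΦ A e φ hK hP U hUQ
    hUt hU0 u v hn huv hv s

/-- **Supply: `S₀` of PRIME dimension with a number field of degree `2 dim S₀` in `End⁰(S₀)`** (a simple CM abelian variety of prime dimension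
`e₀` with CM by `E`; Yanai / Tate–Murasaki, the tree's `EndFieldFullDegree.isStablyNondegenerate_of_prime`): the row of
`weilClassesField_le_algebraicClasses_forall_of_lefschetzB_of_isogenyPair_sqTwistedSquareChart` with NO hypothesis left on the anchor beyond its
`E`-structure. Smallest: `e₀ = 2` — `S₀` a simple CM abelian SURFACE with quartic CM field (Galois or not): compact pencils of abelian EIGHTFOLDS
with `E`-action through `S₀² × S̄₀²`; `B⋆` of the ONE 9-fold total space ⟹ the codimension-2 `E`-Weil classes of every member are algebraic —
OPEN IN PRINT on every component for `E⁺ ≠ ℚ`. [cite: Gordon1999HodgeAVSurvey, Thm. 6.3 with Remark, Thm. 6.4 and Def. 7.6] [cite: Yanai1985, Remark (p. 172)]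
[cite: Deligne1982HodgeCycles, §4 Prop. 4.4 and Remark 4.10] [cite: Andre1996Motifs, §6.3 Lemme 6.3.3 and Remarque 2 (p. 33)] [cite: Andre2026, §4.4.4] -/
theorem weilClassesField_le_algebraicClasses_forall_of_lefschetzB_of_isogenyPair_sqTwistedSquareChart_of_endField_prime
    {F : Type} [Field F] [NumberField F] (ιF : F →+* S₀.endAlgebra) (hF : Module.finrank ℚ F = 2 * S₀.dim) (hp : S₀.dim.Prime)
    (hRm : R.Monic) (hRe : R.natDegree = e₀) (hirr : Irreducible ((R.comp (X ^ 2)).map (Int.castRingHom ℚ)))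
    (hroots : ∀ s : ℂ, Polynomial.eval₂ (Int.castRingHom ℂ) s R = 0 → s.im = 0 ∧ s.re < 0)
    (hηS : Polynomial.eval₂ (Int.castRingHom (CategoryTheory.End S₀)) (ηS : CategoryTheory.End S₀) (R.comp (X ^ 2)) = 0)
    (hS : S₀.dim = e₀)
    (hf : IsCompactAbelianPencil f (2 * 2 * e₀)) (hB : ∀ ηX : complexBetti 𝒳 2, StandardConjectureBStar (2 * 2 * e₀ + 1) 𝒳 ηX)
    (Φ : 𝒳 ⟶ 𝒳) (hΦ : Φ ≫ f = f)
    (A : ComplexPoints S → AbelianVariety ℂ) (e : ∀ s, (A s).X ≅ fiberOver f s) (φ : ∀ s, A s ⟶ A s)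
    (hK : ∀ s, ∃ Φs : fiberOver f s ⟶ fiberOver f s, Φs ≫ fiberι f s = fiberι f s ≫ Φ ∧ (e s).hom ≫ Φs = (φ s).hom.hom.hom ≫ (e s).hom)
    (hP : ∀ s, Polynomial.eval₂ (Int.castRingHom (CategoryTheory.End (A s))) ((φ s : CategoryTheory.End (A s)))
      (R.comp (X ^ 2)) = 0)
    (U : complexBetti 𝒳 (2 * 2)) (hUQ : IsRationalClass U) {t : ComplexPoints S}
    (hUt : complexBetti.map (e t).hom (2 * 2) (complexBetti.map (fiberι f t) (2 * 2) U) ∈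
      weilClassesField (A t) (φ t) (R.comp (X ^ 2)) (2 * 2))
    (hU0 : complexBetti.map (fiberι f t) (2 * 2) U ≠ 0)
    {s₀ : ComplexPoints S} (u : A s₀ ⟶ (S₀.prod S₀).prod (S₀.prod S₀)) (v : (S₀.prod S₀).prod (S₀.prod S₀) ⟶ A s₀) {n : ℕ}
    (hn : 0 < n) (huv : u ≫ v = n • 𝟙 (A s₀))
    (hv : v ≫ φ s₀ =
      AbelianVariety.prodLift
        (AbelianVariety.fst (S₀.prod S₀) (S₀.prod S₀) ≫
          AbelianVariety.prodLift (AbelianVariety.fst S₀ S₀ ≫ ηS) (AbelianVariety.snd S₀ S₀ ≫ ηS))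
        (AbelianVariety.snd (S₀.prod S₀) (S₀.prod S₀) ≫
          (-AbelianVariety.prodLift (AbelianVariety.fst S₀ S₀ ≫ ηS) (AbelianVariety.snd S₀ S₀ ≫ ηS))) ≫ v)
    (s : ComplexPoints S) :
    weilClassesField (A s) (φ s) (R.comp (X ^ 2)) (2 * 2) ≤ algebraicClasses (A s).X 2 :=
  weilClassesField_le_algebraicClasses_forall_of_lefschetzB_of_isogenyPair_sqTwistedSquareChart (by rw [← hS]; exact hp.pos) hRm hRe hirr
    hroots hηS hS (EndFieldFullDegree.isStablyNondegenerate_of_prime ιF hF hp) hf hB Φ hΦ A e φ hK hP U hUQ hUt hU0 u v hn huv hv s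

/-- **… and every member of such a pencil is of Weil type `(R, e₀, 2)` relative to `E`** (no `B⋆`, no HC, no nondegeneracy: §1 at the anchor
`S₀² × S̄₀²`, with the reverse pair `u ≫ (η_T × (−η_T)) = φ_{s₀} ≫ u`, `v ≫ u = n·𝟙`). [cite: Deligne1982HodgeCycles, §4 (4.4), Prop. 4.4 and §5 (c) p. 38]
[cite: MoonenZarhin1998WeilClasses, §1 (Criterion)] -/
theorem isWeilTypeCM_member_of_isogenyPair_sqTwistedSquareChart (he : 0 < e₀) (hRm : R.Monic) (hRe : R.natDegree = e₀)
    (hirr : Irreducible ((R.comp (X ^ 2)).map (Int.castRingHom ℚ)))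
    (hroots : ∀ s : ℂ, Polynomial.eval₂ (Int.castRingHom ℂ) s R = 0 → s.im = 0 ∧ s.re < 0)
    (hηS : Polynomial.eval₂ (Int.castRingHom (CategoryTheory.End S₀)) (ηS : CategoryTheory.End S₀) (R.comp (X ^ 2)) = 0)
    (hS : S₀.dim = e₀)
    (hf : IsCompactAbelianPencil f d) (Φ : 𝒳 ⟶ 𝒳) (hΦ : Φ ≫ f = f)
    (A : ComplexPoints S → AbelianVariety ℂ) (e : ∀ s, (A s).X ≅ fiberOver f s) (φ : ∀ s, A s ⟶ A s)
    (hK : ∀ s, ∃ Φs : fiberOver f s ⟶ fiberOver f s, Φs ≫ fiberι f s = fiberι f s ≫ Φ ∧ (e s).hom ≫ Φs = (φ s).hom.hom.hom ≫ (e s).hom)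
    (hP : ∀ s, Polynomial.eval₂ (Int.castRingHom (CategoryTheory.End (A s))) ((φ s : CategoryTheory.End (A s)))
      (R.comp (X ^ 2)) = 0)
    (U : complexBetti 𝒳 (2 * 2)) (hUQ : IsRationalClass U) {t : ComplexPoints S}
    (hUt : complexBetti.map (e t).hom (2 * 2) (complexBetti.map (fiberι f t) (2 * 2) U) ∈
      weilClassesField (A t) (φ t) (R.comp (X ^ 2)) (2 * 2))
    (hU0 : complexBetti.map (fiberι f t) (2 * 2) U ≠ 0)
    {s₀ : ComplexPoints S} (hdim : (A s₀).dim = ((S₀.prod S₀).prod (S₀.prod S₀)).dim)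
    (u : A s₀ ⟶ (S₀.prod S₀).prod (S₀.prod S₀)) (v : (S₀.prod S₀).prod (S₀.prod S₀) ⟶ A s₀) {n : ℕ} (hn : 0 < n)
    (hvu : v ≫ u = n • 𝟙 ((S₀.prod S₀).prod (S₀.prod S₀)))
    (hu : u ≫ AbelianVariety.prodLift
        (AbelianVariety.fst (S₀.prod S₀) (S₀.prod S₀) ≫
          AbelianVariety.prodLift (AbelianVariety.fst S₀ S₀ ≫ ηS) (AbelianVariety.snd S₀ S₀ ≫ ηS))
        (AbelianVariety.snd (S₀.prod S₀) (S₀.prod S₀) ≫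
          (-AbelianVariety.prodLift (AbelianVariety.fst S₀ S₀ ≫ ηS) (AbelianVariety.snd S₀ S₀ ≫ ηS))) = φ s₀ ≫ u)
    (s : ComplexPoints S) :
    IsWeilTypeCM (A s) (φ s) R e₀ 2 := by
  have hT : (S₀.prod S₀).dim = 2 * e₀ := by rw [AbelianVariety.dim_prod, hS]; ring
  exact isWeilTypeCM_member_of_isogenyPair_twistedSquareChart he two_pos hRm hRe hirr hroots (eval₂_diagSquare_comp_X_sq_eq_zero hηS) hT hf Φ
    hΦ A e φ hK hP U hUQ hUt hU0 hdim u v hn hvu hu s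

end SqTwistedSquare

end Summit.HodgeConjecture.HodgeConjecture.Ring2.AbelianAll

end
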